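import Summits.BirchSwinnertonDyer.BirchSwinnertonDyer.Theorems.GenusKolyvaginAtTwoGenusDeepSupplyAtTwoNegDiscNarrowKFourCellPrintOnly
import Summits.BirchSwinnertonDyer.BirchSwinnertonDyer.Theorems.GenusKolyvaginAtTwoShaCardDvdPowAtTwoRT
import Summits.BirchSwinnertonDyer.BirchSwinnertonDyer.Theorems.GenusKolyvaginAtTwoEquivariantChebotarevAtTwoR
import Summits.BirchSwinnertonDyer.BirchSwinnertonDyer.Theorems.GenusKolyvaginAtTwoCyclicTorsionOfNegDisc
import HarnessLib

/-!
# Route `GenusKolyvaginAtTwo`, crux 23491, K₄ cell at DEPTH ONE (`M₀ = 1`): KOLYVAGIN EXACTNESS `#Ш(E/K)[2^∞] = 4^{M₀}` HOLDS WITHOUT A DEEP WITNESS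
# — so at depth one the kernel K₄ is PURELY «`𝓜₁ = 0`», decoupled from the order of `Ш`

LEAD seat `bsd-line-gk2-p1` g23 (cell `bsd-f1-sign2`), `--supports stmt-BirchSwinnertonDyer-31526 --as helper` (K₄ = `K4Neg`).  THEOREMS ONLY (no definition,
no named fact, no `sorry`).  **BSD is NOT proved by this file; nothing about Kolyvagin's conjecture at `2` is asserted; no item is closed.**

WHY.  On the K₄ cell the route's EXACTNESS crux Q3R_T (`#Ш(E/K)[2^∞] = 4^{M₀}`, stmt-23468, closed) is glued from U_T (`∣ 4^{M₀}`, stmt-23469, PROVED on the cut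
WITHOUT a Kolyvagin witness: PAIRCOUNT + SANDWICH, `shaCardDvdPowAtTwoRT_proof`, modulo Q2/Q5R/Q1) and L_T (`4^{M₀} ∣`, stmt-23659, proved FROM a deep
`2`-primitive witness — the K₄ content).  At the MINIMAL positive depth `M₀ = 1` the lower bound is FREE: the K₄-cell structure already gives `#Ш(E_K)[2] = 4`
(`KFourCell.natCard_shaTorsionBy_two_baseChange_eq_four_of_cell'`, unconditional since p769164), so `4 ≤ #Ш(E_K)[2^∞] ∣ 4`.  Hence:

* `natCard_sha_primary_eq_four_of_cell_of_depth_one` — on the K₄ cell with an odd multiplicative prime (U_T's scope) and `2 ∥ y_K` in `E(K[1])`: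
  **`#Ш(E/K)[2^∞] = 4 = 4^{M₀}`**, modulo the ONE print fact `prop37_2_frobeniusCongruence` (Gross 3.7 (2) / Nekovář 4.9 = item 23091; Q5R and Q1 are tree
  theorems, PT/EP discharged) and the cell-structure binders `rank E(K) = 1`, `Ш(E_K)[2^∞]` finite.
* `sha_primary_addEquiv_zmod_two_sq_of_cell_of_depth_one` — consequently **`Ш(E/K)[2^∞] ≃ ℤ/2 × ℤ/2`** (`= Ш(E_K)[2]`).
READING.  At depth one the BSD-side prediction `e = M₀` (LEAD-BRIEF-g23 §2) is a THEOREM, not an input: the exactness cruxes ask nothing there, and K₄′(ℓ)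
(a deep `ℓ` with `P(ℓ) ∉ 2E(K[ℓ])`, i.e. a level-1 class realising one of `s_y, s′, s″`) is exactly Kolyvagin's `𝓜₁ = 0` with no residue about `#Ш`.
(Kolyvagin's own first step gives such `ℓ` with `P(ℓ) ∉ 4E(K[ℓ])` only — one bit short.)
References: [McCallumLMS1991] §5 Thm. 5.4, Cor. 5.6, Thm. 5.8; [Kolyvagin1991StructureSha]; [GrossLMS1991] §11; [Kramer1981] Thm. 1; [Cassels1962ArithmeticIV].
-/

set_option linter.dupNamespace false -- `Summit.<P>.<Sub>` repeats `BirchSwinnertonDyer` (D-0017)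
set_option autoImplicit false

noncomputable section

open scoped Classical NumberField

namespace Summit.BirchSwinnertonDyer.BirchSwinnertonDyer.Theorems.GenusSupplyNarrow.KFourCell

open WeierstrassCurve NumberField IsDedekindDomain Field Function
open Literature.NumberTheory.EllipticCurves Literature.NumberTheory.GaloisRepresentations
open Literature.NumberTheory.GaloisCohomology Literature.NumberTheory.EllipticCurves.ModularForms
open Literature.NumberTheory.EllipticCurves.GrossLMS1991 (prop37_2_frobeniusCongruence)
open Summit.BirchSwinnertonDyer.BirchSwinnertonDyer.Theses.GenusKolyvaginAtTwo (ShaCardDvdPowAtTwoRT)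

variable (W : WeierstrassCurve ℚ) [W.IsElliptic] [W.IsGloballyMinimal] [NeZero (W.conductorNorm ℤ)] (K : Type) [Field K] [NumberField K]

/-- **KOLYVAGIN EXACTNESS AT DEPTH ONE ON THE K₄ CELL, WITHOUT A WITNESS: `#Ш(E/K)[2^∞] = 4`.**  Frame: the K₄ cell of crux 23491 in U_T's scope —
`W/ℚ` globally minimal, non-CM, `r_an(E) = 0`, `ρ_{E,2^n}` onto for all `n`, `∏ c(E)` odd, an odd prime `v ∣ N_E` of multiplicative reduction, `Δ < 0`,
`#Sel₂(E) = 4`; `K = ℚ(√−ℓ₀)` imaginary quadratic (`ℓ₀` prime, `d_K` odd `≠ −3`), Heegner, the two non-square clauses, `2` split; an odd-Manin datum is NOT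
needed here (any `Dt`); `d₁` with `y_K = P(1)` of infinite order and **`2 ∥ P(1)` in `E(K[1])`** (`M₀ = 1`); a globally minimal twin `Wd ≅ E^{(d_K)}` with
`#Sel₂(Wd) = 2`, `ord₂ C(Wd) ≤ 1`; cell-structure binders `E(K)[2] = 0`, `rank E(K) = 1`, `Ш(E_K)[2^∞]` finite.  MODULO the print fact
`prop37_2_frobeniusCongruence` only.  Proof: U_T (`shaCardDvdPowAtTwoRT_proof`, with Q2 := `GenusExact.kolyvaginRelationAtTwo_of_frobeniusCongruence`,
Q5R := `GenusExact.equivariantChebotarevAtTwoR_proof`, Q1 := `GenusCyclicTorsion.cyclicTorsionOfNegDisc_proof`) gives `#Ш(E_K)[2^∞] ∣ 4`; the cell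
structure gives `#Ш(E_K)[2] = 4` and `Ш[2] ≤ Ш[2^∞]`.  BSD is NOT proved by this. [cite: McCallumLMS1991, §5 Thm. 5.4, Cor. 5.6]
[cite: Kramer1981, Thm. 1] [cite: GrossLMS1991, §11] -/
theorem natCard_sha_primary_eq_four_of_cell_of_depth_one (h37 : prop37_2_frobeniusCongruence)
    (hcm : ¬ W.HasCM) (hr0 : W.analyticRank = 0) (hρ : ∀ n : ℕ, 0 < n → W.HasSurjectiveModNGaloisRep ((2 : ℤ) ^ n))
    (hT : Odd W.tamagawaProduct)
    (v : HeightOneSpectrum (𝓞 ℚ)) (h2v : ((2 : ℕ) : 𝓞 ℚ) ∉ v.asIdeal) (hNv : ((W.conductorNorm ℤ : ℕ) : 𝓞 ℚ) ∈ v.asIdeal)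
    (hmult : W.HasMultiplicativeReductionAt v)
    (hΔ : W.Δ < 0) (h4 : Nat.card (W.selmerGroup 2) = 4)
    (hK : IsImaginaryQuadratic K) (hodd : Odd (discr K)) (h3 : discr K ≠ -3) (hH : SatisfiesHeegnerHypothesis (W.conductorNorm ℤ) K)
    (hsq1 : ¬ IsSquare ((discr K : ℚ) * -|W.Δ|)) (hsq2 : ¬ IsSquare ((discr K : ℚ) * (-(2 * |W.Δ|))))
    (h2K : ((Ideal.span {(2 : ℤ)}).primesOver (𝓞 K)).ncard = 2)
    {ℓ₀ : ℕ} [Fact ℓ₀.Prime] (hd : discr K = -(ℓ₀ : ℤ))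
    (Dt : ModularParametrizationData W (W.conductorNorm ℤ)) (β : ℤ) (ι : K →+* ℂ) (d₁ : KolyvaginHeegnerData Dt β ι 1)
    (hy : ¬ IsOfFinAddOrder d₁.derivedPoint)
    (hdiv : ∃ Q : (W.baseChange (ringClassField K ι 1)).toAffine.Point, ((2 ^ 1 : ℕ) : ℤ) • Q = d₁.derivedPoint)
    (hndiv : ¬ ∃ Q : (W.baseChange (ringClassField K ι 1)).toAffine.Point, ((2 ^ (1 + 1) : ℕ) : ℤ) • Q = d₁.derivedPoint)
    (Wd : WeierstrassCurve ℚ) [Wd.IsElliptic] [Wd.IsGloballyMinimal] (hWd : ∃ C : VariableChange ℚ, C • W.quadraticTwist (discr K : ℚ) = Wd)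
    (hSel : Nat.card (Wd.selmerGroup 2) = 2) (hDEF : padicValNat 2 Wd.tamagawaProduct ≤ 1)
    (hL : ∀ P : (W.baseChange K).toAffine.Point, ((2 : ℕ) : ℤ) • P = 0 → P = 0)
    (hrk : (W.baseChange K).mordellWeilRank = 1)
    [Finite (AddCommGroup.primaryComponent (W.baseChange K).sha 2)] :
    Nat.card (AddCommGroup.primaryComponent (W.baseChange K).sha 2) = 4 := by
  -- U_T on the cut, with Q2 := Gross 3.7 (2), Q5R and Q1 tree theorems: `#Ш(E_K)[2^∞] ∣ 2^(2·1)`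
  have hw : W.rootNumber = 1 := W.rootNumber_eq_one_of_even_analyticRank (by rw [hr0]; exact Even.zero)
  have hUT : Nat.card (AddCommGroup.primaryComponent (W.baseChange K).sha 2) ∣ 2 ^ (2 * 1) :=
    shaCardDvdPowAtTwoRT_proof (GenusExact.kolyvaginRelationAtTwo_of_frobeniusCongruence h37) GenusExact.equivariantChebotarevAtTwoR_proof
      GenusCyclicTorsion.cyclicTorsionOfNegDisc_proof W hcm hT v h2v hNv hmult hΔ K hK hodd h3 hH hsq1 hsq2 hρ Dt β ι d₁ hy 1 hdiv hndiv hw Wd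
      hWd hSel hDEF
  -- the K₄-cell structure: `#Ш(E_K)[2] = 4`, and `Ш[2] ≤ Ш[2^∞]`
  have h4' := (natCard_shaTorsionBy_two_baseChange_eq_four_of_cell' W K hΔ h4 hK hodd hH h2K hd Wd hWd hSel hL hrk).1
  have hsub : AddSubgroup.torsionBy (W.baseChange K).sha ((2 : ℕ) : ℤ) ≤ AddCommGroup.primaryComponent (W.baseChange K).sha 2 := by
    intro x hx
    exact (AddCommGroup.mem_primaryComponent).mpr ⟨1, by
      rw [pow_one, ← natCast_zsmul]
      exact (Submodule.mem_torsionBy_iff ((2 : ℕ) : ℤ) x).mp hx⟩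
  have hle : Nat.card (AddSubgroup.torsionBy (W.baseChange K).sha ((2 : ℕ) : ℤ)) ≤
      Nat.card (AddCommGroup.primaryComponent (W.baseChange K).sha 2) := AddSubgroup.card_le_of_le hsub
  rw [h4'] at hle
  have hpos : 0 < Nat.card (AddCommGroup.primaryComponent (W.baseChange K).sha 2) := Nat.card_pos
  have h44 : (2 : ℕ) ^ (2 * 1) = 4 := by norm_num
  rw [h44] at hUT
  have hle' : Nat.card (AddCommGroup.primaryComponent (W.baseChange K).sha 2) ≤ 4 := Nat.le_of_dvd (by norm_num) hUT
  omega

/-- **`Ш(E/K)[2^∞] ≃ ℤ/2 × ℤ/2` on the K₄ cell at depth one** (so `Ш(E_K)[2^∞] = Ш(E_K)[2]`): the cell structure `Ш(E_K)[2^∞] ≃ (ℤ/2^e)²`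
(`exists_addEquiv_sha_primary_zmod_sq_of_cell'`) with `4^e = 4`.  Same frame and same single print input as
`natCard_sha_primary_eq_four_of_cell_of_depth_one`.  BSD is NOT proved by this. [cite: Cassels1962ArithmeticIV] [cite: Kramer1981, Thm. 1] [cite: McCallumLMS1991, §5 Cor. 5.6] -/
theorem sha_primary_addEquiv_zmod_two_sq_of_cell_of_depth_one (h37 : prop37_2_frobeniusCongruence)
    (hcm : ¬ W.HasCM) (hr0 : W.analyticRank = 0) (hρ : ∀ n : ℕ, 0 < n → W.HasSurjectiveModNGaloisRep ((2 : ℤ) ^ n))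
    (hT : Odd W.tamagawaProduct)
    (v : HeightOneSpectrum (𝓞 ℚ)) (h2v : ((2 : ℕ) : 𝓞 ℚ) ∉ v.asIdeal) (hNv : ((W.conductorNorm ℤ : ℕ) : 𝓞 ℚ) ∈ v.asIdeal)
    (hmult : W.HasMultiplicativeReductionAt v)
    (hΔ : W.Δ < 0) (h4 : Nat.card (W.selmerGroup 2) = 4)
    (hK : IsImaginaryQuadratic K) (hodd : Odd (discr K)) (h3 : discr K ≠ -3) (hH : SatisfiesHeegnerHypothesis (W.conductorNorm ℤ) K)
    (hsq1 : ¬ IsSquare ((discr K : ℚ) * -|W.Δ|)) (hsq2 : ¬ IsSquare ((discr K : ℚ) * (-(2 * |W.Δ|))))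
    (h2K : ((Ideal.span {(2 : ℤ)}).primesOver (𝓞 K)).ncard = 2)
    {ℓ₀ : ℕ} [Fact ℓ₀.Prime] (hd : discr K = -(ℓ₀ : ℤ))
    (Dt : ModularParametrizationData W (W.conductorNorm ℤ)) (β : ℤ) (ι : K →+* ℂ) (d₁ : KolyvaginHeegnerData Dt β ι 1)
    (hy : ¬ IsOfFinAddOrder d₁.derivedPoint)
    (hdiv : ∃ Q : (W.baseChange (ringClassField K ι 1)).toAffine.Point, ((2 ^ 1 : ℕ) : ℤ) • Q = d₁.derivedPoint)
    (hndiv : ¬ ∃ Q : (W.baseChange (ringClassField K ι 1)).toAffine.Point, ((2 ^ (1 + 1) : ℕ) : ℤ) • Q = d₁.derivedPoint)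
    (Wd : WeierstrassCurve ℚ) [Wd.IsElliptic] [Wd.IsGloballyMinimal] (hWd : ∃ C : VariableChange ℚ, C • W.quadraticTwist (discr K : ℚ) = Wd)
    (hSel : Nat.card (Wd.selmerGroup 2) = 2) (hDEF : padicValNat 2 Wd.tamagawaProduct ≤ 1)
    (hL : ∀ P : (W.baseChange K).toAffine.Point, ((2 : ℕ) : ℤ) • P = 0 → P = 0)
    (hrk : (W.baseChange K).mordellWeilRank = 1)
    [Finite (AddCommGroup.primaryComponent (W.baseChange K).sha 2)] :
    Nonempty (AddCommGroup.primaryComponent (W.baseChange K).sha 2 ≃+ ZMod 2 × ZMod 2) := by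
  have hcard := natCard_sha_primary_eq_four_of_cell_of_depth_one W K h37 hcm hr0 hρ hT v h2v hNv hmult hΔ h4 hK hodd h3 hH hsq1 hsq2 h2K hd Dt β ι d₁
    hy hdiv hndiv Wd hWd hSel hDEF hL hrk
  obtain ⟨e, ⟨φ⟩, he⟩ := exists_addEquiv_sha_primary_zmod_sq_of_cell' W K hΔ h4 hK hodd hH h2K hd Wd hWd hSel hL hrk
  -- `4^e = 4` forces `e = 1`
  have he1 : e = 1 := by
    rw [hcard] at he
    have h := Nat.pow_right_injective (le_refl 2) (show 2 ^ (2 * 1) = 2 ^ (2 * e) by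
      rw [pow_mul, pow_mul]; norm_num; exact he)
    omega
  subst he1
  exact ⟨by simpa using φ⟩

end Summit.BirchSwinnertonDyer.BirchSwinnertonDyer.Theorems.GenusSupplyNarrow.KFourCell

end
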